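import Summits.ResolutionOfSingularities.ResolutionOfSingularities.Theorems.FrobeniusClosingPatchingRelPerfectCoreRungTowerCharts
import Summits.ResolutionOfSingularities.ResolutionOfSingularities.Theorems.FrobeniusClosingPatchingRelPerfectCoreRungMonomialCI
import Literature.AlgebraicGeometry.Resolution.RegularSystemOfParameters
import Literature.AlgebraicGeometry.Resolution.RsopMonomialIdeals
import HarnessLib

/-!
# Crux `PatchingRelPerfect` (stmt-ResolutionOfSingularities-16161), chain w52 — CORE RUNG r1τ,
# part 2: the REGULAR-CENTRE TOWER rung `K = (z) + 𝔪ᵈ` (every `d`) and the monomial complete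
# intersections with exponents in `{1, d}`

[OURS · L1 W5.2 · rung r1τ] The blow-up-form open core `stub_atomDimFourBlowup`
(`AtomDimFourBlowupAt p`, skeleton v5.1) restricted to the family `K = (z₁, …, z_m) + 𝔪ᵈ`, `z`
part of a regular system of parameters of a regular local ring `S`, for EVERY `d` — the gap left
by rungs r1c (`d = 2`, `…CoreRungSquarePlusLinear.lean`) and r1d (`…CoreRungMonomialCI.lean`:
"exponent vectors `{1, d ≥ 3}` need the `d`-step point tower along `V(z)`, not in tree").
Assembled from the ring-level tower `isRegular_of_isBlowup_tower`
(`…CoreRungTowerCharts.lean`) with `ι = Fin.castAdd e` (a regular system of parameters is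
quasi-regular with the residue field as quotient).  PROVED, every dimension, every regular local
base, no completeness / characteristic / residue-field hypothesis:

* `isRegular_of_isBlowup_tower_rsop` — every blowing up of `Spec S` along
  `∏_{k<N} ((z) + 𝔪ᵏ⁺¹) = 𝔪 ((z)+𝔪²) ⋯ ((z)+𝔪ᴺ)` is regular (`Bl_𝔪`, then `N − 1` blowing ups
  of the regular centres `L_k ∩ E_k`, `L = V(z)`);
* `companion_span_castAdd_sup_pow_maximalIdeal` / `…_rsopPart_…` — `(z) + 𝔪ᵈ` is in the
  companion class `𝒞` of W2 / r1d (unfolded), companion `Q = 𝔪 ((z)+𝔪²) ⋯ ((z)+𝔪ᵈ⁻¹) ⊇ 𝔪^{(d-1)²}`;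
* `coreRung_span_castAdd_sup_pow_maximalIdeal` / `coreRung_span_rsopPart_sup_pow_maximalIdeal` —
  the core's conclusion for every `T = Bl_K Spec S` (`atomConclusion_of_companion'`);
* `companion_monomialCI_one_pow`, `coreRung_monomialCI_one_pow` — the monomial complete
  intersections `(z₁, …, z_m, y₁ᵈ, …, y_eᵈ)`, `d ≥ 1` (sup-reductions of `(z) + 𝔪ᵈ` by r1a's
  pigeonhole; stub-2's `companion_sup_of_reduction`): in dimension `4` every
  `(x₁^{a₁}, …, x₄^{a₄})` with `aᵢ ∈ {1, d}`;
* `atomDimFourBlowupAt_span_rsopPart_sup_pow_maximalIdeal`, `atomDimFourBlowupAt_monomialCI_one_pow`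
  — the registered core's binder shape restricted to the two families.

FORMAT evidence for the core on these strata only (CHAIN §1 (A), tri-1 (3)): general exponent
vectors still need fan regularity, thickenings `(q) + 𝔪^{d+e}` with SINGULAR initial form are the
located wild kernel (CHAIN v1.2 §4).  Nothing here is a statement of the manuscript under review.

## References

* Q. Liu, *Algebraic Geometry and Arithmetic Curves*, OUP 2002, Thm. 8.1.19 (a). [Liu2002]
* The Stacks Project, Tags 080A, 080B, 0804, 0BIQ. [StacksProject]
* H. Matsumura, *Commutative Ring Theory*, CUP 1986, Thms. 14.2, 16.2. [Matsumura1987]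
-/

-- `Summit.<Summit>.<Sub>.Theorems` with `Sub = Summit` (single-conjunct summit, D-0017)
set_option linter.dupNamespace false

noncomputable section

open CategoryTheory CategoryTheory.Limits AlgebraicGeometry Literature.AlgebraicGeometry.Resolution
open Summit.ResolutionOfSingularities.ResolutionOfSingularities.Theorems.CoreRungTower

namespace Summit.ResolutionOfSingularities.ResolutionOfSingularities.Theorems

universe u

/-! ## The local rung: `K = (z) + 𝔪ᵈ` over a regular local ring -/

section LocalRung

variable {S : Type u} [CommRing S] [IsRegularLocalRing S] {m e : ℕ} (x : Fin (m + e) → S)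
  (hx : Ideal.span (Set.range x) = IsLocalRing.maximalIdeal S)
  (hd : (IsLocalRing.maximalIdeal S).spanFinrank = m + e)

local notation3 "Pz" => Ideal.span (Set.range fun j : Fin m => x (Fin.castAdd e j))

include hx hd in
/-- **The regular-centre tower over a regular local ring.** For a regular system of parameters
`x = (z₁, …, z_m, y₁, …, y_e)` of `S` and every `N`, every blowing up of `Spec S` along
`∏_{k<N} ((z) + 𝔪ᵏ⁺¹) = 𝔪 · ((z) + 𝔪²) ⋯ ((z) + 𝔪ᴺ)` is regular: the point blow-up followed by
`N − 1` blowing ups of the regular centres `L_k ∩ E_k`, `L = V(z)` (ring-level tower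
`isRegular_of_isBlowup_tower` with `ι = Fin.castAdd e`; a regular system of parameters is
quasi-regular with residue field as quotient). [cite: Liu2002, Thm. 8.1.19 (a)]
[cite: StacksProject, Tag 080A] -/
theorem isRegular_of_isBlowup_tower_rsop (N : ℕ) {Y : Scheme.{u}} {f : Y ⟶ Spec (.of S)}
    (hf : IsBlowup f (affineBlowup.idealSheaf (∏ k ∈ Finset.range N,
      (Pz ⊔ IsLocalRing.maximalIdeal S ^ (k + 1))))) :
    Scheme.IsRegular Y := by
  haveI : IsRegularRing S := isRegularRing_of_isRegularLocalRing S
  haveI := isRegularRing_quotient_span_rsop x hx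
  rw [← hx] at hf
  exact isRegular_of_isBlowup_tower N x (Fin.castAdd e) (Fin.castAdd_injective _ _)
    (isQuasiRegular_regularSystemOfParameters hd x hx) ‹_› hf

include hx hd in
/-- **`(z) + 𝔪ᵈ` is in the companion class, for every `d`** (the W2 object of
`…CoreRungClosure.lean`, unfolded): the `𝔪`-primary companion
`Q = ∏_{k<d-1} ((z) + 𝔪ᵏ⁺¹) = 𝔪 · ((z)+𝔪²) ⋯ ((z)+𝔪ᵈ⁻¹) ⊇ 𝔪^{(d-1)²}` has a regular blowing up
of `Spec S` along `((z) + 𝔪ᵈ) · Q = ∏_{k<d} ((z) + 𝔪ᵏ⁺¹)` (the tower; `d = 0`: `K = S`,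
`Q = S`; `d = 1`: `K = 𝔪`, `Q = S`; `d = 2`: `Q = 𝔪`, rung r1c).
[cite: Liu2002, Thm. 8.1.19 (a)] [cite: StacksProject, Tag 080A] -/
theorem companion_span_castAdd_sup_pow_maximalIdeal (d : ℕ) :
    ∃ (Q : Ideal S) (m' : ℕ), IsLocalRing.maximalIdeal S ^ m' ≤ Q ∧
      ∃ (B : Scheme.{u}) (b : B ⟶ Spec (.of S)),
        IsBlowup b (affineBlowup.idealSheaf ((Pz ⊔ IsLocalRing.maximalIdeal S ^ d) * Q)) ∧
        Scheme.IsRegular B := by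
  rcases Nat.eq_zero_or_pos d with rfl | hdpos
  · refine companion_of_forall_isRegular fun B b hb => ?_
    rw [pow_zero, Ideal.one_eq_top, sup_top_eq, affineBlowup.idealSheaf_top] at hb
    haveI : IsIso b := hb.isIso isEffectiveCartier_top
    exact SectionAscent.TraceIdeal.isRegular_of_iso (asIso b) (isRegular_Spec_of_isRegularLocalRing S)
  · obtain ⟨B, b, hb⟩ := exists_isBlowup (Spec (.of S)) (affineBlowup.idealSheaf
      (∏ k ∈ Finset.range d, (Pz ⊔ IsLocalRing.maximalIdeal S ^ (k + 1))))
    refine ⟨∏ k ∈ Finset.range (d - 1), (Pz ⊔ IsLocalRing.maximalIdeal S ^ (k + 1)),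
      (d - 1) * (d - 1), ?_, B, b, ?_, isRegular_of_isBlowup_tower_rsop x hx hd d hb⟩
    · exact pow_mul_le_prod_range _ _ _ _ fun k hk =>
        le_sup_of_le_right (Ideal.pow_le_pow_right (by omega))
    · have hsplit : ∏ k ∈ Finset.range d, (Pz ⊔ IsLocalRing.maximalIdeal S ^ (k + 1)) =
          (Pz ⊔ IsLocalRing.maximalIdeal S ^ d) *
            ∏ k ∈ Finset.range (d - 1), (Pz ⊔ IsLocalRing.maximalIdeal S ^ (k + 1)) := by
        obtain ⟨d', rfl⟩ : ∃ d', d = d' + 1 := ⟨d - 1, by omega⟩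
        rw [Finset.prod_range_succ, mul_comm, Nat.add_sub_cancel]
      rwa [← hsplit]

include hx hd in
/-- **CORE RUNG r1τ in coordinates.** For a regular local `S` with regular system of parameters
`x = (z₁, …, z_m, y₁, …, y_e)`, every `d`, and `K = (z₁, …, z_m) + 𝔪ᵈ ≠ 0`, every blowing up
`f : T ⟶ Spec S` along `K` satisfies the conclusion of the blow-up-form open core
`AtomDimFourBlowupAt`: a non-zero ideal sheaf on `T` cosupported in the closed fibre with regular
blowing up (`J = Q𝒪_T`, `Q = 𝔪 ((z)+𝔪²) ⋯ ((z)+𝔪ᵈ⁻¹)`; model: the regular-centre tower).  Every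
dimension, every regular local base; no completeness, characteristic or residue-field hypothesis.
FORMAT evidence for the core (CHAIN §1 (A)); `d = 2` is rung r1c. [cite: Liu2002, Thm. 8.1.19 (a)]
[cite: StacksProject, Tag 080A] -/
theorem coreRung_span_castAdd_sup_pow_maximalIdeal (d : ℕ)
    (hI : Pz ⊔ IsLocalRing.maximalIdeal S ^ d ≠ ⊥) (T : Scheme.{u}) (f : T ⟶ Spec (.of S))
    (hf : IsBlowup f (affineBlowup.idealSheaf (Pz ⊔ IsLocalRing.maximalIdeal S ^ d))) :
    ∃ (J : T.IdealSheafData) (T' : Scheme.{u}) (π : T' ⟶ T), J ≠ ⊥ ∧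
      (∀ t : T, t ∈ J.support → f.base t = IsLocalRing.closedPoint S) ∧
      IsBlowup π J ∧ Scheme.IsRegular T' :=
  atomConclusion_of_companion' hI (companion_span_castAdd_sup_pow_maximalIdeal x hx hd d) T f hf

/-! ### Monomial complete intersections with exponents in `{1, d}` -/

include hx hd in
/-- **`(z₁, …, z_m, y₁ᵈ, …, y_eᵈ)` is in the companion class** (`d ≥ 1`): it is a sup-reduction
of `(z) + (y)ᵈ = (z) + 𝔪ᵈ` (`(yₖᵈ)_k · ((y)ᵈ)ᵉ = ((y)ᵈ)ᵉ⁺¹`, r1a's pigeonhole), so stub-2's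
closure `companion_sup_of_reduction` applies to the tower companion of `(z) + 𝔪ᵈ`; companion
`((z) + 𝔪ᵈ)ᵉ · 𝔪 ((z)+𝔪²) ⋯ ((z)+𝔪ᵈ⁻¹)`, same regular model.
[cite: StacksProject, Tag 080A] [cite: Liu2002, Thm. 8.1.19 (a)] -/
theorem companion_monomialCI_one_pow (d : ℕ) (hdpos : 0 < d) :
    ∃ (Q : Ideal S) (m' : ℕ), IsLocalRing.maximalIdeal S ^ m' ≤ Q ∧
      ∃ (B : Scheme.{u}) (b : B ⟶ Spec (.of S)),
        IsBlowup b (affineBlowup.idealSheaf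
          ((Pz ⊔ Ideal.span (Set.range fun k : Fin e => x (Fin.natAdd m k) ^ d)) * Q)) ∧
        Scheme.IsRegular B := by
  have hzy := CoreRungMonomialCI.span_castAdd_sup_span_natAdd x hx
  have hK : Pz ⊔ Ideal.span (Set.range fun k : Fin e => x (Fin.natAdd m k)) ^ d =
      Pz ⊔ IsLocalRing.maximalIdeal S ^ d := by
    rw [← hzy]
    exact sup_pow_eq_sup_sup_pow _ _ d
  have hKm : IsLocalRing.maximalIdeal S ^ d ≤
      Pz ⊔ Ideal.span (Set.range fun k : Fin e => x (Fin.natAdd m k)) ^ d := by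
    rw [hK]
    exact le_sup_right
  have hC := companion_span_castAdd_sup_pow_maximalIdeal x hx hd d
  rw [← hK] at hC
  have hle : Ideal.span (Set.range fun k : Fin e => x (Fin.natAdd m k) ^ d) ≤
      Ideal.span (Set.range fun k : Fin e => x (Fin.natAdd m k)) ^ d := by
    rw [Ideal.span_le]
    rintro _ ⟨k, rfl⟩
    exact Ideal.pow_mem_pow (Ideal.subset_span (Set.mem_range_self k)) d
  have hlt : e * (d - 1) < d + d * e :=
    calc e * (d - 1) ≤ e * d := Nat.mul_le_mul_left e (Nat.sub_le d 1)
      _ = d * e := mul_comm e d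
      _ < d + d * e := Nat.lt_add_of_pos_left hdpos
  have hred : Ideal.span (Set.range fun k : Fin e => x (Fin.natAdd m k) ^ d) *
      (Ideal.span (Set.range fun k : Fin e => x (Fin.natAdd m k)) ^ d) ^ e =
        (Ideal.span (Set.range fun k : Fin e => x (Fin.natAdd m k)) ^ d) ^ (e + 1) := by
    rw [← pow_mul, ← pow_mul, show d * (e + 1) = d + d * e by ring]
    exact CoreRung.span_powers_mul_pow_eq_pow _ rfl hlt
  exact companion_sup_of_reduction hle hred hKm hC

include hx in
/-- In positive dimension the ideal `(z₁, …, z_m, y₁ᵈ, …, y_eᵈ)` is non-zero. [folklore] -/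
theorem monomialCI_one_pow_ne_bot (d : ℕ) (h𝔪 : IsLocalRing.maximalIdeal S ≠ ⊥) :
    Pz ⊔ Ideal.span (Set.range fun k : Fin e => x (Fin.natAdd m k) ^ d) ≠ ⊥ := by
  haveI : IsDomain S := isDomain_of_isRegularLocalRing S
  intro h
  apply h𝔪
  rw [← hx, Ideal.span_eq_bot]
  rintro _ ⟨i, rfl⟩
  induction i using Fin.addCases with
  | left j =>
    have hj : x (Fin.castAdd e j) ∈ (⊥ : Ideal S) :=
      h ▸ Ideal.mem_sup_left (Ideal.subset_span (Set.mem_range_self j))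
    simpa using hj
  | right k =>
    have hk : x (Fin.natAdd m k) ^ d ∈ (⊥ : Ideal S) :=
      h ▸ Ideal.mem_sup_right (Ideal.subset_span (Set.mem_range_self k))
    exact (pow_eq_zero_iff' .. |>.mp (by simpa using hk)).1

include hx hd in
/-- **CORE RUNG r1τ — monomial complete intersections with exponents in `{1, d}`.** For a regular
local `S` with regular system of parameters `x = (z₁, …, z_m, y₁, …, y_e)`, `d ≥ 1`, and
`I = (z₁, …, z_m, y₁ᵈ, …, y_eᵈ) ≠ 0`, every blowing up `f : T ⟶ Spec S` along `I` satisfies the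
conclusion of the blow-up-form open core `AtomDimFourBlowupAt` (companion
`((z) + 𝔪ᵈ)ᵉ · 𝔪 ((z)+𝔪²) ⋯ ((z)+𝔪ᵈ⁻¹)`; model: the regular-centre tower).  In dimension `4`:
`(x₁^{a₁}, …, x₄^{a₄})` with every `aᵢ ∈ {1, d}` — extending rungs r1c + r1d (`{1, 2}`).  Every
dimension, every regular local base; FORMAT evidence for the core on this toric stratum.
[cite: StacksProject, Tag 080A] [cite: Liu2002, Thm. 8.1.19 (a)] -/
theorem coreRung_monomialCI_one_pow (d : ℕ) (hdpos : 0 < d)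
    (hI : Pz ⊔ Ideal.span (Set.range fun k : Fin e => x (Fin.natAdd m k) ^ d) ≠ ⊥)
    (T : Scheme.{u}) (f : T ⟶ Spec (.of S))
    (hf : IsBlowup f (affineBlowup.idealSheaf
      (Pz ⊔ Ideal.span (Set.range fun k : Fin e => x (Fin.natAdd m k) ^ d)))) :
    ∃ (J : T.IdealSheafData) (T' : Scheme.{u}) (π : T' ⟶ T), J ≠ ⊥ ∧
      (∀ t : T, t ∈ J.support → f.base t = IsLocalRing.closedPoint S) ∧
      IsBlowup π J ∧ Scheme.IsRegular T' :=
  atomConclusion_of_companion' hI (companion_monomialCI_one_pow x hx hd d hdpos) T f hf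

end LocalRung

/-! ## Coordinate-free forms and the registered binder shape -/

/-- **Companion of `(z) + 𝔪ᵈ` for `z` part of a regular system of parameters** (`IsRsopPart z`),
every `d`. [cite: Liu2002, Thm. 8.1.19 (a)] [cite: StacksProject, Tag 080A] -/
theorem companion_span_rsopPart_sup_pow_maximalIdeal {S : Type u} [CommRing S]
    [IsRegularLocalRing S] {m : ℕ} {z : Fin m → S} (hz : IsRsopPart z) (d : ℕ) :
    ∃ (Q : Ideal S) (m' : ℕ), IsLocalRing.maximalIdeal S ^ m' ≤ Q ∧
      ∃ (B : Scheme.{u}) (b : B ⟶ Spec (.of S)),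
        IsBlowup b (affineBlowup.idealSheaf
          ((Ideal.span (Set.range z) ⊔ IsLocalRing.maximalIdeal S ^ d) * Q)) ∧
        Scheme.IsRegular B := by
  obtain ⟨e, x, hd, hx, hxz⟩ := hz.exists_rsop
  have hzx : (fun j : Fin m => x (Fin.castAdd e j)) = z := funext hxz
  subst hzx
  exact companion_span_castAdd_sup_pow_maximalIdeal x hx hd d

/-- **CORE RUNG r1τ, coordinate-free.** `S` regular local, `z` part of a regular system of
parameters, `d` arbitrary, `K = (z) + 𝔪ᵈ ≠ 0`: every blowing up of `Spec S` along `K` satisfies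
the conclusion of the blow-up-form open core. [cite: Liu2002, Thm. 8.1.19 (a)]
[cite: StacksProject, Tag 080A] -/
theorem coreRung_span_rsopPart_sup_pow_maximalIdeal {S : Type u} [CommRing S]
    [IsRegularLocalRing S] {m : ℕ} {z : Fin m → S} (hz : IsRsopPart z) (d : ℕ)
    (hI : Ideal.span (Set.range z) ⊔ IsLocalRing.maximalIdeal S ^ d ≠ ⊥)
    (T : Scheme.{u}) (f : T ⟶ Spec (.of S))
    (hf : IsBlowup f (affineBlowup.idealSheaf
      (Ideal.span (Set.range z) ⊔ IsLocalRing.maximalIdeal S ^ d))) :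
    ∃ (J : T.IdealSheafData) (T' : Scheme.{u}) (π : T' ⟶ T), J ≠ ⊥ ∧
      (∀ t : T, t ∈ J.support → f.base t = IsLocalRing.closedPoint S) ∧
      IsBlowup π J ∧ Scheme.IsRegular T' :=
  atomConclusion_of_companion' hI (companion_span_rsopPart_sup_pow_maximalIdeal hz d) T f hf

/-- In positive dimension `(z) + 𝔪ᵈ ≠ 0` automatically (and always for `d = 0`). [folklore] -/
theorem span_sup_pow_maximalIdeal_ne_bot {S : Type u} [CommRing S] [IsRegularLocalRing S]
    (h𝔪 : IsLocalRing.maximalIdeal S ≠ ⊥) (𝔞 : Ideal S) (d : ℕ) :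
    𝔞 ⊔ IsLocalRing.maximalIdeal S ^ d ≠ ⊥ := by
  haveI : IsDomain S := isDomain_of_isRegularLocalRing S
  intro h
  exact pow_ne_zero d h𝔪 (eq_bot_iff.mpr (le_sup_right.trans h.le))

/-- **The registered core's binder shape, restricted to the family `(z) + 𝔪ᵈ`.** With exactly the
hypotheses of `stub_atomDimFourBlowup` (`S` regular local of characteristic `p`, `𝔪`-adically
complete, perfect residue field, `dim S = 4`; `I ≠ 0`; `T` a blowing up of `Spec S` along `I`,
regular off the closed fibre) and `I = (z₁, …, z_m) + 𝔪ᵈ` for a part `z` of a regular system of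
parameters and any `d`, the core's conclusion holds.  The dimension, characteristic, completeness,
residue-field and off-fibre hypotheses are not used (underscored). [cite: Liu2002, Thm. 8.1.19 (a)]
[cite: StacksProject, Tag 080A] -/
theorem atomDimFourBlowupAt_span_rsopPart_sup_pow_maximalIdeal (p : ℕ) (_hp : p.Prime) (S : Type)
    [CommRing S] [IsRegularLocalRing S] [CharP S p]
    [IsAdicComplete (IsLocalRing.maximalIdeal S) S]
    [PerfectField (IsLocalRing.ResidueField S)] (_hS : ringKrullDim S = (4 : ℕ))
    {m : ℕ} {z : Fin m → S} (hz : IsRsopPart z) (d : ℕ)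
    (hI : Ideal.span (Set.range z) ⊔ IsLocalRing.maximalIdeal S ^ d ≠ ⊥)
    (T : Scheme.{0}) (f : T ⟶ Spec (.of S))
    (hf : IsBlowup f (affineBlowup.idealSheaf
      (Ideal.span (Set.range z) ⊔ IsLocalRing.maximalIdeal S ^ d)))
    (_hoff : ∀ t : T, f.base t ≠ IsLocalRing.closedPoint S →
      IsRegularLocalRing (T.presheaf.stalk t)) :
    ∃ (J : T.IdealSheafData) (T' : Scheme.{0}) (π : T' ⟶ T), J ≠ ⊥ ∧
      (∀ t : T, t ∈ J.support → f.base t = IsLocalRing.closedPoint S) ∧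
      IsBlowup π J ∧ Scheme.IsRegular T' :=
  coreRung_span_rsopPart_sup_pow_maximalIdeal hz d hI T f hf

/-- **The registered core's binder shape, restricted to the monomial complete intersections with
exponents in `{1, d}`** (`d ≥ 1`): `I = (z₁, …, z_m, y₁ᵈ, …, y_eᵈ)` for a regular system of
parameters `(z, y)`.  The dimension, characteristic, completeness, residue-field and off-fibre
hypotheses are not used (underscored). [cite: StacksProject, Tag 080A] -/
theorem atomDimFourBlowupAt_monomialCI_one_pow (p : ℕ) (_hp : p.Prime) (S : Type)
    [CommRing S] [IsRegularLocalRing S] [CharP S p]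
    [IsAdicComplete (IsLocalRing.maximalIdeal S) S]
    [PerfectField (IsLocalRing.ResidueField S)] (_hS : ringKrullDim S = (4 : ℕ))
    {m e : ℕ} (x : Fin (m + e) → S)
    (hx : Ideal.span (Set.range x) = IsLocalRing.maximalIdeal S)
    (hd : (IsLocalRing.maximalIdeal S).spanFinrank = m + e) (d : ℕ) (hdpos : 0 < d)
    (hI : Ideal.span (Set.range fun j : Fin m => x (Fin.castAdd e j)) ⊔
      Ideal.span (Set.range fun k : Fin e => x (Fin.natAdd m k) ^ d) ≠ ⊥)
    (T : Scheme.{0}) (f : T ⟶ Spec (.of S))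
    (hf : IsBlowup f (affineBlowup.idealSheaf
      (Ideal.span (Set.range fun j : Fin m => x (Fin.castAdd e j)) ⊔
        Ideal.span (Set.range fun k : Fin e => x (Fin.natAdd m k) ^ d))))
    (_hoff : ∀ t : T, f.base t ≠ IsLocalRing.closedPoint S →
      IsRegularLocalRing (T.presheaf.stalk t)) :
    ∃ (J : T.IdealSheafData) (T' : Scheme.{0}) (π : T' ⟶ T), J ≠ ⊥ ∧
      (∀ t : T, t ∈ J.support → f.base t = IsLocalRing.closedPoint S) ∧
      IsBlowup π J ∧ Scheme.IsRegular T' :=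
  coreRung_monomialCI_one_pow x hx hd d hdpos hI T f hf

end Summit.ResolutionOfSingularities.ResolutionOfSingularities.Theorems

end
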